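import Mathlib.Analysis.Matrix.Spectrum
import Mathlib.LinearAlgebra.Matrix.Kronecker
import Mathlib.LinearAlgebra.Matrix.Charpoly.Basic
import HarnessLib

/-!
# Spectral sums of Hermitian matrices through the characteristic polynomial

Topic `Literature/Computability/AlgebraicComplexity`; support file for the quantum functionals
(`QuantumFunctionals.lean`, Christandl–Vrana–Zuiddam, *Universal points in the asymptotic spectrum of
tensors*, JAMS 36 (2023), §3.2). The quantum (von Neumann) entropy of a marginal of a pure state is a
*spectral sum* `∑ᵢ f(λᵢ)` over the eigenvalues `λᵢ` of a Hermitian matrix (`f = -x log x` after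
normalisation). The proofs of CVZ Thm. 3.19 (unit tensors, super-additivity, super-multiplicativity,
monotonicity of the lower quantum functional) only ever use such sums through four elementary facts of
matrix analysis, proved here once and for all from Mathlib's
`Matrix.IsHermitian.roots_charpoly_eq_eigenvalues` (the multiset of eigenvalues is the multiset of roots
of the characteristic polynomial):

* `sum_eigenvalues_eq_roots_sum` — `∑ᵢ f(λᵢ(A)) = ∑_{z ∈ roots(χ_A)} f(Re z)`; hence spectral sums only
  depend on the characteristic polynomial (`sum_eigenvalues_eq_of_charpoly_eq`), and agree for two
  Hermitian matrices of possibly different sizes with `X^a χ_A = X^b χ_B` as soon as `f 0 = 0`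
  (`sum_eigenvalues_eq_of_X_pow_mul_charpoly_eq`).
* `X_pow_mul_charpoly_isometry_conj` — for an isometry `V` (`Vᴴ V = 1`, rectangular),
  `X^n χ_{V M Vᴴ} = X^m χ_M` (from `Matrix.charpoly_mul_comm'`); so isometric conjugation does not change
  spectral sums with `f 0 = 0` (`sum_eigenvalues_isometry_conj`).
* `IsHermitian.charpoly_real_smul`, `IsHermitian.charpoly_kronecker` — `χ_{cA} = ∏ (X - cλᵢ)` and
  `χ_{A ⊗ₖ B} = ∏_{(i,j)} (X - λᵢ(A) λⱼ(B))` (spectral theorem + unitary conjugation), with the spectral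
  sums `sum_eigenvalues_real_smul`, `sum_eigenvalues_kronecker`.
* `sum_eigenvalues_fromBlocks` — the spectral sum of a block-diagonal Hermitian matrix is the sum of
  the spectral sums of the blocks (`Matrix.charpoly_fromBlocks_zero₁₂`).

All statements are over an `RCLike` field `𝕜`. No definitions are introduced.

## Mathlib search

Mathlib (tag v4.32.0) has the spectral theorem, `eigenvalues`, `charpoly_eq`/`roots_charpoly_eq_eigenvalues`,
`charpoly_mul_comm'`, `charpoly_fromBlocks_zero₁₂`, but no statement about the eigenvalues of a
Kronecker product, of a block-diagonal matrix, of a scalar multiple, or of an isometric conjugate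
(searched `eigenvalues_kronecker`, `eigenvalues_fromBlocks`, `eigenvalues_smul`, `charpoly_kronecker`).
-/

noncomputable section

open scoped BigOperators Matrix Kronecker
open Polynomial

namespace Literature.Computability.AlgebraicComplexity

variable {𝕜 : Type*} [RCLike 𝕜]
variable {n m : Type*} [Fintype n] [Fintype m] [DecidableEq n] [DecidableEq m]

/-! ## Spectral sums are root sums of the characteristic polynomial -/

/-- For a Hermitian matrix `A` and any `f : ℝ → ℝ`, `∑ᵢ f(λᵢ(A))` is the sum of `f ∘ Re` over the
multiset of roots of the characteristic polynomial of `A`. [folklore] -/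
theorem sum_eigenvalues_eq_roots_sum {A : Matrix n n 𝕜} (hA : A.IsHermitian) (f : ℝ → ℝ) :
    ∑ i, f (hA.eigenvalues i) = (A.charpoly.roots.map fun z => f (RCLike.re z)).sum := by
  rw [hA.roots_charpoly_eq_eigenvalues, Multiset.map_map, Finset.sum_eq_multiset_sum]
  congr 1
  refine Multiset.map_congr rfl fun i _ => ?_
  simp

/-- Spectral sums of Hermitian matrices only depend on the characteristic polynomial (the matrices
may have different index types). [folklore] -/
theorem sum_eigenvalues_eq_of_charpoly_eq {A : Matrix n n 𝕜} {B : Matrix m m 𝕜} (hA : A.IsHermitian)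
    (hB : B.IsHermitian) (h : A.charpoly = B.charpoly) (f : ℝ → ℝ) :
    ∑ i, f (hA.eigenvalues i) = ∑ j, f (hB.eigenvalues j) := by
  rw [sum_eigenvalues_eq_roots_sum hA, sum_eigenvalues_eq_roots_sum hB, h]

/-- If `X^a χ_A = X^b χ_B` for Hermitian `A`, `B` (so the nonzero spectra agree with multiplicity),
then `∑ᵢ f(λᵢ(A)) = ∑ⱼ f(λⱼ(B))` for every `f` with `f 0 = 0`. [folklore] -/
theorem sum_eigenvalues_eq_of_X_pow_mul_charpoly_eq {A : Matrix n n 𝕜} {B : Matrix m m 𝕜}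
    (hA : A.IsHermitian) (hB : B.IsHermitian) {a b : ℕ}
    (h : X ^ a * A.charpoly = X ^ b * B.charpoly) {f : ℝ → ℝ} (hf : f 0 = 0) :
    ∑ i, f (hA.eigenvalues i) = ∑ j, f (hB.eigenvalues j) := by
  have hA0 : A.charpoly ≠ 0 := (Matrix.charpoly_monic A).ne_zero
  have hB0 : B.charpoly ≠ 0 := (Matrix.charpoly_monic B).ne_zero
  have hXa : (X ^ a : 𝕜[X]) ≠ 0 := pow_ne_zero _ X_ne_zero
  have hXb : (X ^ b : 𝕜[X]) ≠ 0 := pow_ne_zero _ X_ne_zero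
  have hr := congrArg (fun p : 𝕜[X] => (p.roots.map fun z => f (RCLike.re z)).sum) h
  simp only [roots_mul (mul_ne_zero hXa hA0), roots_mul (mul_ne_zero hXb hB0), roots_X_pow,
    Multiset.map_add, Multiset.sum_add, Multiset.map_nsmul, Multiset.map_singleton, map_zero, hf,
    Multiset.sum_nsmul, Multiset.sum_singleton, smul_zero, zero_add] at hr
  rw [sum_eigenvalues_eq_roots_sum hA, sum_eigenvalues_eq_roots_sum hB, hr]

/-- Roots of `∏ᵢ (X - C (g i))` are the values `g i` with multiplicity. [folklore] -/
theorem roots_prod_X_sub_C_fun {ι : Type*} [Fintype ι] (g : ι → 𝕜) :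
    (∏ i, (X - C (g i))).roots = Finset.univ.val.map g := by
  have h : ∏ i, (X - C (g i)) = ((Finset.univ.val.map g).map fun a => X - C a).prod := by
    rw [Multiset.map_map, Finset.prod_eq_multiset_prod]
    rfl
  rw [h, roots_multiset_prod_X_sub_C]

/-! ## Isometric and unitary conjugation -/

section Conj

variable {R : Type*} [CommRing R]

/-- For a rectangular isometry `V : m × n` (`Vᴴ V = 1`) and a square `M`,
`X^{|n|} χ_{V M Vᴴ} = X^{|m|} χ_M`: conjugating by an isometry only adds zero eigenvalues
(`Matrix.charpoly_mul_comm'`). [folklore] -/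
theorem X_pow_mul_charpoly_isometry_conj [StarRing R] (V : Matrix m n R) (M : Matrix n n R)
    (hV : Vᴴ * V = 1) :
    X ^ Fintype.card n * (V * M * Vᴴ).charpoly = X ^ Fintype.card m * M.charpoly := by
  rw [Matrix.mul_assoc, Matrix.charpoly_mul_comm' V (M * Vᴴ), Matrix.mul_assoc, hV, Matrix.mul_one]

/-- Conjugation by `U` with `U' U = 1` does not change the characteristic polynomial:
`χ_{U M U'} = χ_M`. [folklore] -/
theorem charpoly_conj_of_mul_eq_one (U U' M : Matrix n n R) (hU : U' * U = 1) :
    (U * M * U').charpoly = M.charpoly := by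
  rw [Matrix.mul_assoc, Matrix.charpoly_mul_comm, Matrix.mul_assoc, hU, Matrix.mul_one]

end Conj

/-- Isometric conjugation preserves spectral sums with `f 0 = 0`: if `Vᴴ V = 1` then
`∑ f(λ(V M Vᴴ)) = ∑ f(λ(M))` for Hermitian `M` (the hypothesis `hVMV` is supplied by Mathlib's
`Matrix.isHermitian_mul_mul_conjTranspose V hM`). [folklore] -/
theorem sum_eigenvalues_isometry_conj {M : Matrix n n 𝕜} (hM : M.IsHermitian) (V : Matrix m n 𝕜)
    (hV : Vᴴ * V = 1) (hVMV : (V * M * Vᴴ).IsHermitian) {f : ℝ → ℝ} (hf : f 0 = 0) :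
    ∑ j, f (hVMV.eigenvalues j) = ∑ i, f (hM.eigenvalues i) :=
  sum_eigenvalues_eq_of_X_pow_mul_charpoly_eq hVMV hM (X_pow_mul_charpoly_isometry_conj V M hV) hf

/-! ## Scalar multiples and Kronecker products of Hermitian matrices -/

namespace IsHermitianAux

/-- The spectral theorem in product form: `A = U · diag(λ) · U⋆` with `U⋆ U = 1`. [folklore] -/
theorem spectral_factorisation {A : Matrix n n 𝕜} (hA : A.IsHermitian) :
    ∃ U : Matrix n n 𝕜, star U * U = 1 ∧ U * star U = 1 ∧
      A = U * Matrix.diagonal (RCLike.ofReal ∘ hA.eigenvalues) * star U := by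
  refine ⟨(hA.eigenvectorUnitary : Matrix n n 𝕜), Unitary.coe_star_mul_self _,
    Unitary.coe_mul_star_self _, ?_⟩
  have h := hA.spectral_theorem
  rwa [Unitary.conjStarAlgAut_apply] at h

end IsHermitianAux

open IsHermitianAux

/-- The characteristic polynomial of a real scalar multiple of a Hermitian matrix:
`χ_{cA} = ∏ᵢ (X - c λᵢ(A))`. [folklore] -/
theorem IsHermitian.charpoly_real_smul {A : Matrix n n 𝕜} (hA : A.IsHermitian) (c : ℝ) :
    ((c : 𝕜) • A).charpoly = ∏ i, (X - C ((c * hA.eigenvalues i : ℝ) : 𝕜)) := by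
  obtain ⟨U, hU, -, hAU⟩ := spectral_factorisation hA
  have h1 : (c : 𝕜) • A = U * Matrix.diagonal (fun i => ((c * hA.eigenvalues i : ℝ) : 𝕜)) * star U := by
    conv_lhs => rw [hAU]
    rw [← Matrix.smul_mul, ← Matrix.mul_smul]
    congr 2
    ext i j
    simp [Matrix.diagonal_apply, RCLike.ofReal_mul]
  rw [h1, charpoly_conj_of_mul_eq_one U (star U) _ hU, Matrix.charpoly_diagonal]

/-- Spectral sums of a real scalar multiple: `∑ f(λ(cA)) = ∑ᵢ f(c λᵢ(A))`. [folklore] -/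
theorem sum_eigenvalues_real_smul {A : Matrix n n 𝕜} (hA : A.IsHermitian) (c : ℝ)
    (hcA : ((c : 𝕜) • A).IsHermitian) (f : ℝ → ℝ) :
    ∑ i, f (hcA.eigenvalues i) = ∑ i, f (c * hA.eigenvalues i) := by
  rw [sum_eigenvalues_eq_roots_sum hcA, IsHermitian.charpoly_real_smul hA c, roots_prod_X_sub_C_fun,
    Multiset.map_map, Finset.sum_eq_multiset_sum]
  congr 1
  refine Multiset.map_congr rfl fun i _ => ?_
  simp

omit [Fintype n] [DecidableEq n] in
/-- A real scalar multiple of a Hermitian matrix is Hermitian. [folklore] -/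
theorem isHermitian_real_smul {A : Matrix n n 𝕜} (hA : A.IsHermitian) (c : ℝ) :
    ((c : 𝕜) • A).IsHermitian := by
  unfold Matrix.IsHermitian at hA ⊢
  rw [Matrix.conjTranspose_smul, hA, RCLike.star_def, RCLike.conj_ofReal]

/-- The characteristic polynomial of the Kronecker product of two Hermitian matrices:
`χ_{A ⊗ₖ B} = ∏_{(i,j)} (X - λᵢ(A) λⱼ(B))`. [folklore] -/
theorem IsHermitian.charpoly_kronecker {A : Matrix n n 𝕜} {B : Matrix m m 𝕜} (hA : A.IsHermitian)
    (hB : B.IsHermitian) :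
    (A ⊗ₖ B).charpoly =
      ∏ p : n × m, (X - C ((hA.eigenvalues p.1 * hB.eigenvalues p.2 : ℝ) : 𝕜)) := by
  obtain ⟨U, hU, -, hAU⟩ := spectral_factorisation hA
  obtain ⟨W, hW, -, hBW⟩ := spectral_factorisation hB
  have hst : star U ⊗ₖ star W = star (U ⊗ₖ W) := by
    rw [Matrix.star_eq_conjTranspose, Matrix.star_eq_conjTranspose, Matrix.star_eq_conjTranspose,
      Matrix.conjTranspose_kronecker]
  have hUW : star (U ⊗ₖ W) * (U ⊗ₖ W) = 1 := by
    rw [← hst, ← Matrix.mul_kronecker_mul, hU, hW, Matrix.one_kronecker_one]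
  have h1 : A ⊗ₖ B = (U ⊗ₖ W) *
      Matrix.diagonal (fun p : n × m => ((hA.eigenvalues p.1 * hB.eigenvalues p.2 : ℝ) : 𝕜)) *
        star (U ⊗ₖ W) := by
    conv_lhs => rw [hAU, hBW]
    rw [Matrix.mul_kronecker_mul, Matrix.mul_kronecker_mul, Matrix.diagonal_kronecker_diagonal, hst]
    congr 2
    ext p q
    simp [Matrix.diagonal_apply, RCLike.ofReal_mul]
  rw [h1, charpoly_conj_of_mul_eq_one _ _ _ hUW, Matrix.charpoly_diagonal]

omit [Fintype n] [Fintype m] [DecidableEq n] [DecidableEq m] in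
/-- The Kronecker product of Hermitian matrices is Hermitian. [folklore] -/
theorem isHermitian_kronecker {A : Matrix n n 𝕜} {B : Matrix m m 𝕜} (hA : A.IsHermitian)
    (hB : B.IsHermitian) : (A ⊗ₖ B).IsHermitian := by
  unfold Matrix.IsHermitian at hA hB ⊢
  rw [Matrix.conjTranspose_kronecker, hA, hB]

/-- Spectral sums of a Kronecker product: `∑ f(λ(A ⊗ₖ B)) = ∑ᵢ ∑ⱼ f(λᵢ(A) λⱼ(B))`. [folklore] -/
theorem sum_eigenvalues_kronecker {A : Matrix n n 𝕜} {B : Matrix m m 𝕜} (hA : A.IsHermitian)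
    (hB : B.IsHermitian) (hAB : (A ⊗ₖ B).IsHermitian) (f : ℝ → ℝ) :
    ∑ p, f (hAB.eigenvalues p) = ∑ i, ∑ j, f (hA.eigenvalues i * hB.eigenvalues j) := by
  rw [sum_eigenvalues_eq_roots_sum hAB, IsHermitian.charpoly_kronecker hA hB, roots_prod_X_sub_C_fun,
    Multiset.map_map, ← Finset.sum_eq_multiset_sum, Fintype.sum_prod_type]
  refine Finset.sum_congr rfl fun i _ => Finset.sum_congr rfl fun j _ => ?_
  simp

/-! ## Block-diagonal matrices -/

omit [Fintype n] [Fintype m] [DecidableEq n] [DecidableEq m] in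
/-- A block-diagonal matrix with Hermitian blocks is Hermitian. [folklore] -/
theorem isHermitian_fromBlocks_zero {A : Matrix n n 𝕜} {B : Matrix m m 𝕜} (hA : A.IsHermitian)
    (hB : B.IsHermitian) : (Matrix.fromBlocks A 0 0 B).IsHermitian :=
  hA.fromBlocks (by simp) hB

/-- Spectral sums of a block-diagonal Hermitian matrix add up:
`∑ f(λ(A ⊕ B)) = ∑ f(λ(A)) + ∑ f(λ(B))`. [folklore] -/
theorem sum_eigenvalues_fromBlocks {A : Matrix n n 𝕜} {B : Matrix m m 𝕜} (hA : A.IsHermitian)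
    (hB : B.IsHermitian) (hAB : (Matrix.fromBlocks A 0 0 B).IsHermitian) (f : ℝ → ℝ) :
    ∑ p, f (hAB.eigenvalues p) = ∑ i, f (hA.eigenvalues i) + ∑ j, f (hB.eigenvalues j) := by
  have hA0 : A.charpoly ≠ 0 := (Matrix.charpoly_monic A).ne_zero
  have hB0 : B.charpoly ≠ 0 := (Matrix.charpoly_monic B).ne_zero
  rw [sum_eigenvalues_eq_roots_sum hAB, sum_eigenvalues_eq_roots_sum hA, sum_eigenvalues_eq_roots_sum hB,
    Matrix.charpoly_fromBlocks_zero₁₂, roots_mul (mul_ne_zero hA0 hB0), Multiset.map_add,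
    Multiset.sum_add]

/-! ## The trace as a spectral sum -/

/-- `∑ᵢ λᵢ(A) = Re (tr A)`. [folklore] -/
theorem sum_eigenvalues_eq_re_trace {A : Matrix n n 𝕜} (hA : A.IsHermitian) :
    ∑ i, hA.eigenvalues i = RCLike.re A.trace := by
  rw [hA.trace_eq_sum_eigenvalues, map_sum]
  simp

end Literature.Computability.AlgebraicComplexity

end
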